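import Literature.Probability.LatticeModels.FourFunctionsInfiniteProduct
import Literature.Probability.LatticeModels.IsoradialPercolation
import Literature.Probability.Percolation.Percolation
import Literature.Probability.Percolation.PositiveAssociation
import Mathlib.Probability.Distributions.SetBernoulli
import HarnessLib

/-!
# The four functions theorem for product Bernoulli measures on INFINITE index sets
# (Batty–Bollmann 1980, Cor. 3.9, Bernoulli case): `prodBernoulli`, `setBer(u, p)`, bond percolation `P_p`

CITATION HEADER.  Source: C. J. K. Batty, H. W. Bollmann, *Generalised Holley–Preston inequalities on measure
spaces and their products*, Z. Wahrsch. verw. Gebiete **53** (1980) 157–173 [BattyBollmann1980], Cor. 3.9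
("The direct product of any family of selectively paired probability spaces is 𝔐-expansive"), §1 (1.5) (FKG),
(1.6)/(1.8) (Holley–Preston) as special cases of (1.13); p. 159: "Seymour and Welsh [14, 15] have shown how (1.5),
(1.6) and (1.8) are important in combinatorial and percolation theory."  Tree: the general infinite-product theorem
`Literature.Probability.LatticeModels.BattyBollmann.lintegral_four_functions_infinitePi`
(`FourFunctionsInfiniteProduct.lean`); the FINITE-`ι` Bernoulli case was already
`Literature.Probability.Percolation.prodBernoulli_fourFunctions` (`FourFunctionsProdBernoulli.lean`, from Mathlib's
finite four functions theorem).

## What is formalised (theorems only; no definitions, no named facts)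

The two-point space `Prop` (`False < True`) is a chain, and the tree's `prodBernoulli p` / Mathlib's `setBer(u, p)`
/ the tree's `bondPercolation G p` are push-forwards of `Measure.infinitePi` over `ι → Prop` along the lattice
isomorphism `q ↦ {i | q i}` onto `(Set ι, ∪, ∩)`.  Hence, for an ARBITRARY index set `ι` / ARBITRARY graph `G`:

* `lintegral_four_functions_map_setOf`, `prodBernoulli_lintegral_four_functions`,
  `setBernoulli_lintegral_four_functions`, `bondPercolation_lintegral_four_functions` — measurable
  `f₁, f₂, f₃, f₄ : Set ι → [0,∞]` with `f₁(a) f₂(b) ≤ f₃(a ∩ b) f₄(a ∪ b)` for all `a, b` satisfy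
  `(∫⁻f₁)(∫⁻f₂) ≤ (∫⁻f₃)(∫⁻f₄)` (the tree's finite convention: `f₃` at the meet, `f₄` at the join).
* `prodBernoulli_lintegral_holley` — Holley–Preston (1.6)/(1.8): weights with `ρ₁(a) ρ₂(b) ≤ ρ₁(a ∩ b) ρ₂(a ∪ b)`
  and increasing measurable `φ ≥ 0` give `(∫⁻ φρ₁)(∫⁻ ρ₂) ≤ (∫⁻ ρ₁)(∫⁻ φρ₂)`.
* `mIsSetTP2_withDensity_map_setOf/_prodBernoulli/_setBernoulli/_bondPercolation`, `mIsSetTP2_prodBernoulli`,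
  `isPositivelyAssociated_withDensity_prodBernoulli/_bondPercolation` — (1.5): every MEASURABLE weight `ρ` with the FKG lattice condition
  `ρ(a) ρ(b) ≤ ρ(a ∩ b) ρ(a ∪ b)` at every pair defines a set-TP₂ tilt `ρ · P_p`, positively associated
  (`IsPositivelyAssociated`, the tree's Harris–FKG property) once normalised — FKG for Gibbs modifications of
  Bernoulli percolation on infinite graphs with no finite-range / continuity assumption on the weight.
-/

noncomputable section

open MeasureTheory Measure Set Function ProbabilityTheory unitInterval
open Literature.Probability.LatticeModels Literature.Probability.LatticeModels.BattyBollmann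
open Literature.Probability.LatticeModels.Affiliation
open scoped ENNReal SetFamily

namespace Literature.Probability.Percolation

variable {ι : Type*}

/-! ### Transport along `q ↦ {i | q i}` -/

/-- `{i | (q ⊔ q') i} = {i | q i} ∪ {i | q' i}`. [folklore] -/
private theorem setOf_sup (q q' : ι → Prop) : {i | (q ⊔ q') i} = {i | q i} ∪ {i | q' i} := by
  ext i
  simp only [Pi.sup_apply, sup_Prop_eq, mem_setOf_eq, mem_union]

/-- `{i | (q ⊓ q') i} = {i | q i} ∩ {i | q' i}`. [folklore] -/
private theorem setOf_inf (q q' : ι → Prop) : {i | (q ⊓ q') i} = {i | q i} ∩ {i | q' i} := by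
  ext i
  simp only [Pi.inf_apply, inf_Prop_eq, mem_setOf_eq, mem_inter_iff]

/-- **[BattyBollmann1980] Cor. 3.9 for a product of two-point chains, transported to `(Set ι, ∪, ∩)`**: for ANY
family `ν i` of probability measures on `Prop` and measurable `f₁,…,f₄ : Set ι → [0,∞]` with
`f₁(a) f₂(b) ≤ f₃(a ∩ b) f₄(a ∪ b)` for all `a, b`, under `μ = (⊗ᵢ νᵢ).map (q ↦ {i | q i})`:
`(∫⁻f₁ dμ)(∫⁻f₂ dμ) ≤ (∫⁻f₃ dμ)(∫⁻f₄ dμ)`. [cite: BattyBollmann1980, Cor. 3.9] -/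
theorem lintegral_four_functions_map_setOf (ν : ι → Measure Prop) [∀ i, IsProbabilityMeasure (ν i)]
    {f₁ f₂ f₃ f₄ : Set ι → ℝ≥0∞} (hm₁ : Measurable f₁) (hm₂ : Measurable f₂) (hm₃ : Measurable f₃)
    (hm₄ : Measurable f₄) (h : ∀ a b, f₁ a * f₂ b ≤ f₃ (a ∩ b) * f₄ (a ∪ b)) :
    (∫⁻ a, f₁ a ∂(infinitePi ν).map fun q : ι → Prop => {i | q i}) *
        (∫⁻ a, f₂ a ∂(infinitePi ν).map fun q : ι → Prop => {i | q i}) ≤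
      (∫⁻ a, f₃ a ∂(infinitePi ν).map fun q : ι → Prop => {i | q i}) *
        (∫⁻ a, f₄ a ∂(infinitePi ν).map fun q : ι → Prop => {i | q i}) := by
  rw [lintegral_map hm₁ measurable_setOf, lintegral_map hm₂ measurable_setOf, lintegral_map hm₃ measurable_setOf,
    lintegral_map hm₄ measurable_setOf]
  have AD := lintegral_four_functions_infinitePi ν (hm₁.comp measurable_setOf) (hm₂.comp measurable_setOf)
    (hm₄.comp measurable_setOf) (hm₃.comp measurable_setOf) (fun x y => by
      show f₁ {i | x i} * f₂ {i | y i} ≤ f₄ {i | (x ⊔ y) i} * f₃ {i | (x ⊓ y) i}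
      rw [setOf_sup, setOf_inf, mul_comm (f₄ _)]
      exact h _ _)
  calc (∫⁻ q, f₁ {i | q i} ∂infinitePi ν) * (∫⁻ q, f₂ {i | q i} ∂infinitePi ν)
      ≤ (∫⁻ q, f₄ {i | q i} ∂infinitePi ν) * (∫⁻ q, f₃ {i | q i} ∂infinitePi ν) := AD
    _ = (∫⁻ q, f₃ {i | q i} ∂infinitePi ν) * (∫⁻ q, f₄ {i | q i} ∂infinitePi ν) := mul_comm _ _

/-! ### `prodBernoulli`, `setBer(u, p)`, bond percolation -/

/-- **The four functions theorem for the inhomogeneous product Bernoulli measure `prodBernoulli p` on `Set ι`, ANY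
index set `ι`** (the tree's `prodBernoulli_fourFunctions` needs `ι` finite): measurable `f₁,…,f₄ : Set ι → [0,∞]`
with `f₁(a) f₂(b) ≤ f₃(a ∩ b) f₄(a ∪ b)` for all `a, b` satisfy `(∫⁻f₁)(∫⁻f₂) ≤ (∫⁻f₃)(∫⁻f₄)`.
[cite: BattyBollmann1980, Cor. 3.9] -/
theorem prodBernoulli_lintegral_four_functions (p : ι → unitInterval) {f₁ f₂ f₃ f₄ : Set ι → ℝ≥0∞}
    (hm₁ : Measurable f₁) (hm₂ : Measurable f₂) (hm₃ : Measurable f₃) (hm₄ : Measurable f₄)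
    (h : ∀ a b, f₁ a * f₂ b ≤ f₃ (a ∩ b) * f₄ (a ∪ b)) :
    (∫⁻ a, f₁ a ∂prodBernoulli p) * (∫⁻ a, f₂ a ∂prodBernoulli p) ≤
      (∫⁻ a, f₃ a ∂prodBernoulli p) * (∫⁻ a, f₄ a ∂prodBernoulli p) := by
  rw [prodBernoulli_eq_map]
  exact lintegral_four_functions_map_setOf _ hm₁ hm₂ hm₃ hm₄ h

/-- **The four functions theorem for Mathlib's `setBer(u, p)` on `Set ι`, ANY `ι` and `u`.**
[cite: BattyBollmann1980, Cor. 3.9] -/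
theorem setBernoulli_lintegral_four_functions (u : Set ι) (p : unitInterval) {f₁ f₂ f₃ f₄ : Set ι → ℝ≥0∞}
    (hm₁ : Measurable f₁) (hm₂ : Measurable f₂) (hm₃ : Measurable f₃) (hm₄ : Measurable f₄)
    (h : ∀ a b, f₁ a * f₂ b ≤ f₃ (a ∩ b) * f₄ (a ∪ b)) :
    (∫⁻ a, f₁ a ∂setBer(u, p)) * (∫⁻ a, f₂ a ∂setBer(u, p)) ≤
      (∫⁻ a, f₃ a ∂setBer(u, p)) * (∫⁻ a, f₄ a ∂setBer(u, p)) := by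
  rw [setBernoulli_eq_map]
  exact lintegral_four_functions_map_setOf _ hm₁ hm₂ hm₃ hm₄ h

/-- **The four functions theorem for Bernoulli bond percolation `P_p` on an ARBITRARY (infinite) graph**:
measurable `f₁,…,f₄ : BondConfig V → [0,∞]` with `f₁(ω) f₂(ω') ≤ f₃(ω ∩ ω') f₄(ω ∪ ω')` for all configurations
satisfy `(∫⁻f₁ dP_p)(∫⁻f₂ dP_p) ≤ (∫⁻f₃ dP_p)(∫⁻f₄ dP_p)`. [cite: BattyBollmann1980, Cor. 3.9] -/
theorem bondPercolation_lintegral_four_functions {V : Type*} (G : SimpleGraph V) (p : unitInterval)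
    {f₁ f₂ f₃ f₄ : BondConfig V → ℝ≥0∞} (hm₁ : Measurable f₁) (hm₂ : Measurable f₂) (hm₃ : Measurable f₃)
    (hm₄ : Measurable f₄) (h : ∀ a b, f₁ a * f₂ b ≤ f₃ (a ∩ b) * f₄ (a ∪ b)) :
    (∫⁻ a, f₁ a ∂bondPercolation G p) * (∫⁻ a, f₂ a ∂bondPercolation G p) ≤
      (∫⁻ a, f₃ a ∂bondPercolation G p) * (∫⁻ a, f₄ a ∂bondPercolation G p) :=
  setBernoulli_lintegral_four_functions _ p hm₁ hm₂ hm₃ hm₄ h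

/-! ### Holley–Preston and FKG for measurable tilts of product Bernoulli measures -/

/-- **Holley–Preston (1.6)/(1.8) under `prodBernoulli p`, any `ι`, `[0,∞]`-valued form**: measurable weights with
`ρ₁(a) ρ₂(b) ≤ ρ₁(a ∩ b) ρ₂(a ∪ b)` at every pair and a measurable increasing `φ ≥ 0` give
`(∫⁻ φρ₁)(∫⁻ ρ₂) ≤ (∫⁻ ρ₁)(∫⁻ φρ₂)`. [cite: BattyBollmann1980, Cor. 3.9 with (1.6)–(1.8)] -/
theorem prodBernoulli_lintegral_holley (p : ι → unitInterval) {ρ₁ ρ₂ φ : Set ι → ℝ≥0∞} (hρ₁ : Measurable ρ₁)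
    (hρ₂ : Measurable ρ₂) (hφm : Measurable φ) (hφ : Monotone φ)
    (hH : ∀ a b, ρ₁ a * ρ₂ b ≤ ρ₁ (a ∩ b) * ρ₂ (a ∪ b)) :
    (∫⁻ a, φ a * ρ₁ a ∂prodBernoulli p) * (∫⁻ a, ρ₂ a ∂prodBernoulli p) ≤
      (∫⁻ a, ρ₁ a ∂prodBernoulli p) * (∫⁻ a, φ a * ρ₂ a ∂prodBernoulli p) := by
  have AD := prodBernoulli_lintegral_four_functions p (hφm.mul hρ₁) hρ₂ hρ₁ (hφm.mul hρ₂) fun a b =>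
    calc φ a * ρ₁ a * ρ₂ b = φ a * (ρ₁ a * ρ₂ b) := mul_assoc _ _ _
      _ ≤ φ (a ∪ b) * (ρ₁ (a ∩ b) * ρ₂ (a ∪ b)) := mul_le_mul' (hφ subset_union_left) (hH a b)
      _ = ρ₁ (a ∩ b) * (φ (a ∪ b) * ρ₂ (a ∪ b)) := by ring
  calc (∫⁻ a, φ a * ρ₁ a ∂prodBernoulli p) * (∫⁻ a, ρ₂ a ∂prodBernoulli p)
      ≤ (∫⁻ a, ρ₁ a ∂prodBernoulli p) * (∫⁻ a, φ a * ρ₂ a ∂prodBernoulli p) := AD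

/-- **(1.5): measurable FKG-lattice tilts of a product of two-point laws, transported to `(Set ι, ∪, ∩)`, are
set-TP₂** ([MullerStoyan2002] Thm. 3.10.14 (ii), density-free form): for ANY family `ν i` of probability measures
on `Prop`, `μ = (⊗ᵢ νᵢ).map (q ↦ {i | q i})`, and a measurable `ρ : Set ι → [0,∞]` with
`ρ(a) ρ(b) ≤ ρ(a ∩ b) ρ(a ∪ b)` at every pair, `ν = ρ · μ` satisfies `ν(A) ν(B) ≤ ν(A ⊼ B) ν(A ⊻ B)` for all
measurable `A, B ⊆ Set ι` (`⊼ = {a ∩ b}`, `⊻ = {a ∪ b}`, image sets read with outer measure).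
[cite: BattyBollmann1980, Cor. 3.9 with Remark 3.1(d)] -/
theorem mIsSetTP2_withDensity_map_setOf (ν : ι → Measure Prop) [∀ i, IsProbabilityMeasure (ν i)]
    (ρ : Set ι → ℝ≥0∞) (hρ : Measurable ρ) (hL : ∀ a b, ρ a * ρ b ≤ ρ (a ∩ b) * ρ (a ∪ b)) :
    mIsSetTP2 (((infinitePi ν).map fun q : ι → Prop => {i | q i}).withDensity ρ) := by
  intro A B hA hB
  set P := (infinitePi ν).map fun q : ι → Prop => {i | q i} with hP
  set μ := P.withDensity ρ with hμ
  set T₃ := toMeasurable μ (A ⊼ B) with hT₃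
  set T₄ := toMeasurable μ (A ⊻ B) with hT₄
  have mT₃ : MeasurableSet T₃ := measurableSet_toMeasurable _ _
  have mT₄ : MeasurableSet T₄ := measurableSet_toMeasurable _ _
  have AD := lintegral_four_functions_map_setOf ν (hρ.indicator hA) (hρ.indicator hB) (hρ.indicator mT₃)
    (hρ.indicator mT₄) (fun a b => by
      by_cases ha : a ∈ A
      · by_cases hb : b ∈ B
        · have h3 : a ∩ b ∈ T₃ := subset_toMeasurable _ _ (Set.inf_mem_infs ha hb)
          have h4 : a ∪ b ∈ T₄ := subset_toMeasurable _ _ (Set.sup_mem_sups ha hb)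
          rw [indicator_of_mem ha, indicator_of_mem hb, indicator_of_mem h3, indicator_of_mem h4]
          exact hL a b
        · rw [indicator_of_notMem hb, mul_zero]
          exact zero_le
      · rw [indicator_of_notMem ha, zero_mul]
        exact zero_le)
  rw [lintegral_indicator hA, lintegral_indicator hB, lintegral_indicator mT₃, lintegral_indicator mT₄,
    ← withDensity_apply ρ hA, ← withDensity_apply ρ hB, ← withDensity_apply ρ mT₃,
    ← withDensity_apply ρ mT₄] at AD
  rw [← hμ, hT₃, hT₄, measure_toMeasurable, measure_toMeasurable] at AD
  exact AD

/-- **Measurable FKG-lattice tilts of `prodBernoulli p` are set-TP₂**, any `ι`, no finite-range or continuity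
assumption on the weight. [cite: BattyBollmann1980, Cor. 3.9 with Remark 3.1(d)] -/
theorem mIsSetTP2_withDensity_prodBernoulli (p : ι → unitInterval) (ρ : Set ι → ℝ≥0∞) (hρ : Measurable ρ)
    (hL : ∀ a b, ρ a * ρ b ≤ ρ (a ∩ b) * ρ (a ∪ b)) : mIsSetTP2 ((prodBernoulli p).withDensity ρ) := by
  rw [prodBernoulli_eq_map]
  exact mIsSetTP2_withDensity_map_setOf _ ρ hρ hL

/-- **Measurable FKG-lattice tilts of `setBer(u, p)` are set-TP₂**, any `ι`, `u`.
[cite: BattyBollmann1980, Cor. 3.9 with Remark 3.1(d)] -/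
theorem mIsSetTP2_withDensity_setBernoulli (u : Set ι) (p : unitInterval) (ρ : Set ι → ℝ≥0∞)
    (hρ : Measurable ρ) (hL : ∀ a b, ρ a * ρ b ≤ ρ (a ∩ b) * ρ (a ∪ b)) :
    mIsSetTP2 ((setBer(u, p)).withDensity ρ) := by
  rw [setBernoulli_eq_map]
  exact mIsSetTP2_withDensity_map_setOf _ ρ hρ hL

/-- **`prodBernoulli p` itself is set-TP₂ on `(Set ι, ∪, ∩)` for ANY index set** (Daykin/Ahlswede–Daykin for the
weighted cube, infinite `ι`; the tree's `prodBernoulli_ahlswedeDaykin` needs `ι` finite).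
[cite: BattyBollmann1980, Cor. 3.9 with Remark 3.1(b)] -/
theorem mIsSetTP2_prodBernoulli (p : ι → unitInterval) : mIsSetTP2 (prodBernoulli p) := by
  have h := mIsSetTP2_withDensity_prodBernoulli p (fun _ => 1) measurable_const (fun a b => le_rfl)
  rwa [show (fun _ : Set ι => (1 : ℝ≥0∞)) = 1 from rfl, withDensity_one] at h

/-- **FKG (1.5) for measurable lattice-condition tilts of `prodBernoulli p`, as positive association**: if moreover
`∫ ρ dP = 1`, the probability measure `ρ · prodBernoulli p` is positively associated —
`ν(A) ν(B) ≤ ν(A ∩ B)` for increasing measurable events (hence the covariance form for bounded increasing functions,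
tree `IsPositivelyAssociated.integral_mul_integral_le_integral_mul`).
[cite: BattyBollmann1980, Cor. 3.9 with (1.5)] -/
theorem isPositivelyAssociated_withDensity_prodBernoulli (p : ι → unitInterval) (ρ : Set ι → ℝ≥0∞)
    (hρ : Measurable ρ) (hL : ∀ a b, ρ a * ρ b ≤ ρ (a ∩ b) * ρ (a ∪ b))
    (h1 : ∫⁻ a, ρ a ∂prodBernoulli p = 1) : IsPositivelyAssociated ((prodBernoulli p).withDensity ρ) := by
  intro A B hA hB hAm hBm
  have h := (mIsSetTP2_withDensity_prodBernoulli p ρ hρ hL).mIsAffiliated.upperSet_mul_le hAm hBm hA hB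
  rwa [withDensity_apply ρ MeasurableSet.univ, Measure.restrict_univ, h1, mul_one] at h

/-- **Bond percolation: measurable FKG-lattice tilts of `P_p` on any graph are set-TP₂.**
[cite: BattyBollmann1980, Cor. 3.9 with Remark 3.1(d)] -/
theorem mIsSetTP2_withDensity_bondPercolation {V : Type*} (G : SimpleGraph V) (p : unitInterval)
    (ρ : BondConfig V → ℝ≥0∞) (hρ : Measurable ρ) (hL : ∀ a b, ρ a * ρ b ≤ ρ (a ∩ b) * ρ (a ∪ b)) :
    mIsSetTP2 ((bondPercolation G p).withDensity ρ) :=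
  mIsSetTP2_withDensity_setBernoulli _ p ρ hρ hL

/-- **Bond percolation: normalised measurable FKG-lattice tilts of `P_p` on any graph are positively associated**
(Harris–FKG for Gibbs modifications of Bernoulli percolation with an arbitrary measurable lattice-condition weight).
[cite: BattyBollmann1980, Cor. 3.9 with (1.5)] -/
theorem isPositivelyAssociated_withDensity_bondPercolation {V : Type*} (G : SimpleGraph V) (p : unitInterval)
    (ρ : BondConfig V → ℝ≥0∞) (hρ : Measurable ρ) (hL : ∀ a b, ρ a * ρ b ≤ ρ (a ∩ b) * ρ (a ∪ b))
    (h1 : ∫⁻ a, ρ a ∂bondPercolation G p = 1) : IsPositivelyAssociated ((bondPercolation G p).withDensity ρ) := by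
  intro A B hA hB hAm hBm
  have h := (mIsSetTP2_withDensity_bondPercolation G p ρ hρ hL).mIsAffiliated.upperSet_mul_le hAm hBm hA hB
  rwa [withDensity_apply ρ MeasurableSet.univ, Measure.restrict_univ, h1, mul_one] at h

end Literature.Probability.Percolation
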